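import Literature.MathematicalPhysics.QuantumFieldTheory.AdhikariCao2022.CorrelationDecay

/-!
# Adhikari–Cao (2022/2025), §3: the general swapping argument (Definition 3.1, Lemma 3.2 — proved),
# and Remark 1.2: Wilson loop observables as instances of Theorem 1.1

Companion to `CorrelationDecay.lean` (same directory, same namespace), which types Theorem 1.1 of

* A. Adhikari, S. Cao, *Correlation decay for finite lattice gauge theories at weak coupling*,
  Ann. Probab. **53** (2025) 140–174, arXiv:2202.10375 (v3 = accepted version) [AdhikariCao2025]

as the named fact `correlationDecay`. Numbering below is that of arXiv v3 (one counter per section,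
shared by theorems, lemmas, propositions, definitions and remarks; read from the LaTeX source).

## What is here

**(A) §3 "A general swapping argument", in the printed generality, PROVED.** The paper isolates the
model-independent half of its proof ("the underlying idea of the proof, which is quite general and,
in principle, could be applied to other types of spin systems or statistical mechanical models",
§1 after Remark 1.2):

* Definition 3.1 (*swapping map*): for a finite probability space `(Ω, ν)`, a set `E ⊆ Ω²`,
  functions `h₁, h₂ : Ω → ℂ`, a map `T : E → E` is a swapping map w.r.t. `(E, h₁, h₂, ν)` if it is a
  bijection and for all `(ψ₁, ψ₂) ∈ E`: (1) `ν^{⊗2}(T(ψ₁,ψ₂)) = ν^{⊗2}((ψ₁,ψ₂))`, (2) writing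
  `(ψ̃₁, ψ̃₂) = T(ψ₁, ψ₂)`, `h₁(ψ₁) h₂(ψ₂) = h₁(ψ̃₁) h₂(ψ̃₁)`. — `IsSwappingMap`.
* Lemma 3.2: if `T` is a swapping map w.r.t. `(E, h₁, h₂, ν)` and `Ψ₁, Ψ₂` are i.i.d. `∼ ν`, then
  `|Cov(h₁(Ψ₁), h₂(Ψ₁))| ≤ 2 ‖h₁‖_∞ ‖h₂‖_∞ P((Ψ₁, Ψ₂) ∉ E)`. — `norm_fcov_le_of_isSwappingMap`
  (with explicit bounds `M₁, M₂` in place of the sup norms) and `norm_fcov_le_of_isSwappingMap'`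
  (as printed), proved by the printed argument: the claim (3.1)
  `E[h₁(Ψ₁)h₂(Ψ₁) 1_F] = E[h₁(Ψ₁)h₂(Ψ₂) 1_F]`, `F = {(Ψ₁,Ψ₂) ∈ E}`, by re-indexing the sum along the
  bijection `T` (`swapping_claim`), then the two trivial bounds on `F^c`.
  In the paper `Ω = Hom(π₁(S₁(Λ), x₀), G)` with the push-forward measure `ν_{Λ,β}`; the proof uses
  nothing about that space, so the lemma is stated for an arbitrary finite type `Ω` with a probability
  weight `ν` (`ν ≥ 0`, `Σ ν = 1`) — this is the statement as printed, read literally. It is then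
  instantiated on the configuration space `(G^{Λ₁}, μ_{Λ,β})` of `CorrelationDecay.lean`
  (`norm_cov_le_of_isSwappingMap`; proved API `partitionFn_pos`, `gibbsProb_nonneg`,
  `sum_gibbsProb_eq_one`, `expect_eq_fexpect`, `cov_eq_fcov`).

**Where the finiteness of `G` enters the printed proof of Theorem 1.1 (recorded, NOT typed — the
objects are internal: based homomorphisms, supports, knot decompositions).** Theorem 1.1 is obtained
(proof after Prop. 3.3) from Lemma 2.12 (switch from `Σ ∼ μ_{Λ,β}` to the random homomorphism
`Ψ ∼ ν_{Λ,β}`), Lemma 3.2 (here, group-agnostic) and Proposition 3.3 = Corollary 5.6 (construction of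
the swapping map `T` on the event `E(B₁,B₂)` of Definition 5.1) + Proposition 6.1 (the Peierls
bound `P((Ψ₁,Ψ₂) ∉ E(B₁,B₂)) ≤ 2(4·10²⁴|G|²)^{|B₁|+|B₂|} e^{−(β/2)Δ_G(L−1)}`). The order `|G|` and
the gap `Δ_G` enter Proposition 6.1 exactly through Lemma 2.8 (the number of `ψ` with
`supp(ψ) = P` is at most `|G|^{|P|}`, from [Cao2020, Lemma 4.3.7]), Lemma 6.7
(`Φ⁽²⁾_{P₀}(P) ≤ 4^{|P|} |G|^{2|P|} e^{−βΔ_G|P − P₀|}`: each excited plaquette costs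
`φ_β ≤ e^{−βΔ_G}`) and the threshold `β ≥ (1/Δ_G)(114 + 4 log|G|)`, used as
`4·10²⁴|G|² e^{−(β/2)Δ_G} ≤ 1`; the lattice-animal count Lemma 4.8 (`≤ (10²⁴)^m` knots of size `m`
containing a given plaquette, cf. [Cao2020, Lemma 4.3.4]) is group-independent.

**(B) §1.2 / Remark 1.2: Wilson loop observables, PROVED instances of the named fact.** The Wilson
loop observable `W_{γ,χ₀}(σ) := χ₀(σ_γ)` (§1.2) on the cube vocabulary of `CorrelationDecay.lean`
(`wilsonLoopObservable`; the tree's walk-based objects on the infinite lattice are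
`Literature.MathematicalPhysics.QuantumLattice.wilsonLoopObs` (real class functions, `LGConfig`) and
`Literature.MathematicalPhysics.QuantumFieldTheory.Cao2020.wilsonLoopVar` — different carriers, not
restated here); characters are class functions (`character_conj`), "arbitrary functions of
arbitrary numbers of Wilson loop observables" are conjugacy invariant in the sense of Theorem 1.1
(`isConjInvariant_of_classFunctions`); and the two corollaries of `correlationDecay` announced in
Remark 1.2, derived from the fact `(h : correlationDecay)` (no new assumption):
`correlationDecay.classFunctions` and `correlationDecay.wilsonLoops`
(`|Cov(W_{γ₁,χ₁}, W_{γ₂,χ₂})| ≤ 4(4·10²⁴|G|²)^{|B₁|+|B₂|} ‖χ₁‖_∞‖χ₂‖_∞ e^{−(β/2)Δ_G(L−1)}` for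
characters `χ_i = Tr ρ_i` of representations `ρ_i`, loops `γ_i ⊆ B_i`), plus the explicit-constant
form `correlationDecay.wilsonLoops_unitary` (`‖χ_i‖_∞ ≤ d_i` for unitary `ρ_i`,
`norm_character_le`).

No new named fact is introduced (net debt 0); nothing here is a claim about compact gauge groups or
continuum Yang–Mills. `G` is finite wherever a measure appears, as in the source.
-/

noncomputable section

open Finset

namespace Literature.MathematicalPhysics.QuantumFieldTheory.AdhikariCao2022

/-! ### Sup norms -/

section SupNorm

variable {Ω : Type*}

/-- `‖h‖_∞ := sup_{ω ∈ Ω} |h(ω)|` for a complex function on a (finite) set `Ω` (a maximum when `Ω` is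
finite and non-empty; Mathlib's junk value `0` for an empty `Ω`). This is the `‖·‖_∞` of Lemma 3.2;
`supNorm` of `CorrelationDecay.lean` is the special case `Ω = G^k` (`supNorm_eq_linftyNorm`).
[cite: AdhikariCao2025, Lemma 3.2] -/
def linftyNorm (h : Ω → ℂ) : ℝ := ⨆ ω, ‖h ω‖

/-- `‖h‖_∞ ≥ 0`. [cite: AdhikariCao2025, Lemma 3.2] -/
theorem linftyNorm_nonneg (h : Ω → ℂ) : 0 ≤ linftyNorm h :=
  Real.iSup_nonneg fun ω => norm_nonneg (h ω)

/-- `|h(ω)| ≤ ‖h‖_∞` on a finite set. [cite: AdhikariCao2025, Lemma 3.2] -/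
theorem norm_le_linftyNorm [Finite Ω] (h : Ω → ℂ) (ω : Ω) : ‖h ω‖ ≤ linftyNorm h :=
  le_ciSup (f := fun ω => ‖h ω‖) (Set.finite_range _).bddAbove ω

/-- `‖h‖_∞ ≤ M` as soon as `|h(ω)| ≤ M` for all `ω` and `M ≥ 0`. [cite: AdhikariCao2025, Lemma 3.2] -/
theorem linftyNorm_le {h : Ω → ℂ} {M : ℝ} (hM : 0 ≤ M) (hh : ∀ ω, ‖h ω‖ ≤ M) : linftyNorm h ≤ M := by
  unfold linftyNorm
  rcases isEmpty_or_nonempty Ω with hΩ | hΩ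
  · simp [hM]
  · exact ciSup_le hh

/-- The sup norm `supNorm` of Theorem 1.1 (`CorrelationDecay.lean`, functions on `G^k`) is the sup norm
`linftyNorm` on `Ω = G^k` (definitionally). [cite: AdhikariCao2025, Thm. 1.1] -/
theorem supNorm_eq_linftyNorm {G : Type*} {k : ℕ} (f : (Fin k → G) → ℂ) :
    supNorm f = linftyNorm f := rfl

end SupNorm

/-! ### §3 — finite probability spaces: expectation, covariance, the two-fold product -/

section FiniteProbability

variable {Ω : Type*}

/-- **Definition 3.1 (swapping map), in the printed generality.** `Ω` a (finite) set carrying a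
weight `ν : Ω → ℝ` (in the paper `Ω = Hom(π₁(S₁(Λ),x₀),G)`, `ν = ν_{Λ,β}`), `E ⊆ Ω²`,
`h₁, h₂ : Ω → ℂ` arbitrary functions. A map `T` (typed as a self-map of `Ω²`; only its restriction to
`E` matters) "is a swapping map with respect to `(E, h₁, h₂, ν)` if `T : E → E` is a bijection, and if
additionally the following hold for all `(ψ₁, ψ₂) ∈ E`: (1) `ν^{⊗2}(T(ψ₁, ψ₂)) = ν^{⊗2}((ψ₁, ψ₂))`
for the two-fold product `ν^{⊗2}` of `ν` on `Ω²`; (2) writing `(ψ̃₁, ψ̃₂) = T(ψ₁, ψ₂)`,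
`h₁(ψ₁) h₂(ψ₂) = h₁(ψ̃₁) h₂(ψ̃₁)`." [cite: AdhikariCao2025, Def. 3.1] -/
structure IsSwappingMap (ν : Ω → ℝ) (E : Finset (Ω × Ω)) (h₁ h₂ : Ω → ℂ)
    (T : Ω × Ω → Ω × Ω) : Prop where
  /-- `T : E → E` is a bijection -/
  bijOn : Set.BijOn T (E : Set (Ω × Ω)) (E : Set (Ω × Ω))
  /-- (1) `T` preserves the product weight `ν^{⊗2}(ψ₁,ψ₂) = ν(ψ₁)ν(ψ₂)` on `E` -/
  weight_eq : ∀ p ∈ E, ν (T p).1 * ν (T p).2 = ν p.1 * ν p.2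
  /-- (2) `h₁(ψ₁) h₂(ψ₂) = h₁(ψ̃₁) h₂(ψ̃₁)` where `(ψ̃₁, ψ̃₂) = T(ψ₁, ψ₂)` -/
  swap_eq : ∀ p ∈ E, h₁ p.1 * h₂ p.2 = h₁ (T p).1 * h₂ (T p).1

variable [Fintype Ω]

/-- `E[h(Ψ)] = Σ_ω ν(ω) h(ω)` for `Ψ ∼ ν` on the finite set `Ω`. [cite: AdhikariCao2025, §3] -/
def fexpect (ν : Ω → ℝ) (h : Ω → ℂ) : ℂ := ∑ ω, (ν ω : ℂ) * h ω

/-- `Cov(h₁(Ψ), h₂(Ψ)) = E[h₁(Ψ)h₂(Ψ)] − E[h₁(Ψ)]E[h₂(Ψ)]`, `Ψ ∼ ν` (bilinear, no conjugation, as in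
the proof of Lemma 3.2). [cite: AdhikariCao2025, Lemma 3.2] -/
def fcov (ν : Ω → ℝ) (h₁ h₂ : Ω → ℂ) : ℂ :=
  fexpect ν (fun ω => h₁ ω * h₂ ω) - fexpect ν h₁ * fexpect ν h₂

/-- `P((Ψ₁, Ψ₂) ∉ E) = Σ_{(ψ₁,ψ₂) ∉ E} ν(ψ₁)ν(ψ₂)` for `Ψ₁, Ψ₂` i.i.d. `∼ ν` (the two-fold product
`ν^{⊗2}` of the complement of `E`). [cite: AdhikariCao2025, Lemma 3.2] -/
def pairProbNotMem [DecidableEq Ω] (ν : Ω → ℝ) (E : Finset (Ω × Ω)) : ℝ :=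
  ∑ p ∈ Eᶜ, ν p.1 * ν p.2

/-- `P((Ψ₁, Ψ₂) ∉ E) ≥ 0` for a non-negative weight. [cite: AdhikariCao2025, Lemma 3.2] -/
theorem pairProbNotMem_nonneg [DecidableEq Ω] {ν : Ω → ℝ} (hν : ∀ ω, 0 ≤ ν ω)
    (E : Finset (Ω × Ω)) : 0 ≤ pairProbNotMem ν E :=
  Finset.sum_nonneg fun p _ => mul_nonneg (hν p.1) (hν p.2)

omit [Fintype Ω] in
/-- **The claim (3.1) in the proof of Lemma 3.2**: `E[h₁(Ψ₁)h₂(Ψ₁) 1_F] = E[h₁(Ψ₁)h₂(Ψ₂) 1_F]`,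
`F = {(Ψ₁,Ψ₂) ∈ E}` — "since `T : E → E` is a bijection" the left sum re-indexes along `T`, and
conditions (1), (2) of Definition 3.1 turn each summand into the corresponding right summand.
[cite: AdhikariCao2025, Lemma 3.2 (proof, eq. (3.1))] -/
theorem swapping_claim {ν : Ω → ℝ} {E : Finset (Ω × Ω)} {h₁ h₂ : Ω → ℂ} {T : Ω × Ω → Ω × Ω}
    (hT : IsSwappingMap ν E h₁ h₂ T) :
    ∑ p ∈ E, ((ν p.1 * ν p.2 : ℝ) : ℂ) * (h₁ p.1 * h₂ p.1) =
      ∑ p ∈ E, ((ν p.1 * ν p.2 : ℝ) : ℂ) * (h₁ p.1 * h₂ p.2) := by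
  have key : ∑ p ∈ E, ((ν (T p).1 * ν (T p).2 : ℝ) : ℂ) * (h₁ (T p).1 * h₂ (T p).1) =
      ∑ q ∈ E, ((ν q.1 * ν q.2 : ℝ) : ℂ) * (h₁ q.1 * h₂ q.1) :=
    Finset.sum_nbij T (fun a ha => hT.bijOn.mapsTo ha) hT.bijOn.injOn hT.bijOn.surjOn
      (fun a _ => rfl)
  rw [← key]
  refine Finset.sum_congr rfl fun p hp => ?_
  rw [hT.weight_eq p hp, ← hT.swap_eq p hp]

/-- `E[h₁(Ψ₁)h₂(Ψ₁)]` written on the product space: `Σ_{(ψ₁,ψ₂)} ν(ψ₁)ν(ψ₂) h₁(ψ₁)h₂(ψ₁)`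
(uses `Σ ν = 1`). [cite: AdhikariCao2025, Lemma 3.2 (proof)] -/
theorem fexpect_mul_eq_sum_prod {ν : Ω → ℝ} (hν₁ : ∑ ω, ν ω = 1) (h₁ h₂ : Ω → ℂ) :
    fexpect ν (fun ω => h₁ ω * h₂ ω) =
      ∑ p : Ω × Ω, ((ν p.1 * ν p.2 : ℝ) : ℂ) * (h₁ p.1 * h₂ p.1) := by
  have hν₁' : ∑ b : Ω, (ν b : ℂ) = 1 := by exact_mod_cast hν₁
  rw [Fintype.sum_prod_type]
  unfold fexpect
  refine Finset.sum_congr rfl fun a _ => ?_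
  have : ∀ b : Ω, ((ν a * ν b : ℝ) : ℂ) * (h₁ a * h₂ a) = ((ν a : ℂ) * (h₁ a * h₂ a)) * (ν b : ℂ) := by
    intro b; push_cast; ring
  simp_rw [this]
  rw [← Finset.mul_sum, hν₁', mul_one]

/-- `E[h₁(Ψ₁)] E[h₂(Ψ₂)] = Σ_{(ψ₁,ψ₂)} ν(ψ₁)ν(ψ₂) h₁(ψ₁)h₂(ψ₂)` (Fubini on a finite product).
[cite: AdhikariCao2025, Lemma 3.2 (proof)] -/
theorem fexpect_mul_fexpect_eq_sum_prod (ν : Ω → ℝ) (h₁ h₂ : Ω → ℂ) :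
    fexpect ν h₁ * fexpect ν h₂ =
      ∑ p : Ω × Ω, ((ν p.1 * ν p.2 : ℝ) : ℂ) * (h₁ p.1 * h₂ p.2) := by
  unfold fexpect
  rw [Finset.sum_mul_sum, Fintype.sum_prod_type]
  refine Finset.sum_congr rfl fun a _ => Finset.sum_congr rfl fun b _ => ?_
  push_cast; ring

/-- **Lemma 3.2 (a swapping map gives a covariance bound), proved — explicit-bound form.** If `T` is
a swapping map with respect to `(E, h₁, h₂, ν)` (`ν` a probability weight on the finite set `Ω`),
`|h₁| ≤ M₁` and `|h₂| ≤ M₂` pointwise, then `|Cov(h₁(Ψ₁), h₂(Ψ₁))| ≤ 2 M₁ M₂ P((Ψ₁, Ψ₂) ∉ E)`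
for `Ψ₁, Ψ₂` i.i.d. `∼ ν`. Printed proof: by the claim (3.1) (`swapping_claim`),
`Cov = E[h₁(Ψ₁)h₂(Ψ₁) 1_{F^c}] − E[h₁(Ψ₁)h₂(Ψ₂) 1_{F^c}]`, and both terms are trivially bounded by
`M₁ M₂ P(F^c)`. [cite: AdhikariCao2025, Lemma 3.2] -/
theorem norm_fcov_le_of_isSwappingMap [DecidableEq Ω] {ν : Ω → ℝ} (hν : ∀ ω, 0 ≤ ν ω)
    (hν₁ : ∑ ω, ν ω = 1) {E : Finset (Ω × Ω)} {h₁ h₂ : Ω → ℂ} {T : Ω × Ω → Ω × Ω}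
    (hT : IsSwappingMap ν E h₁ h₂ T) {M₁ M₂ : ℝ} (hM₁ : ∀ ω, ‖h₁ ω‖ ≤ M₁)
    (hM₂ : ∀ ω, ‖h₂ ω‖ ≤ M₂) :
    ‖fcov ν h₁ h₂‖ ≤ 2 * M₁ * M₂ * pairProbNotMem ν E := by
  -- split both product-space sums over `E` and `Eᶜ`; the `E`-parts cancel by the claim (3.1)
  have hsplit : fcov ν h₁ h₂ =
      ∑ p ∈ Eᶜ, ((ν p.1 * ν p.2 : ℝ) : ℂ) * (h₁ p.1 * h₂ p.1) -
        ∑ p ∈ Eᶜ, ((ν p.1 * ν p.2 : ℝ) : ℂ) * (h₁ p.1 * h₂ p.2) := by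
    unfold fcov
    rw [fexpect_mul_eq_sum_prod hν₁, fexpect_mul_fexpect_eq_sum_prod,
      ← Finset.sum_add_sum_compl E, ← Finset.sum_add_sum_compl E, swapping_claim hT]
    ring
  -- the trivial bound on `F^c`
  have key : ∀ X : Ω × Ω → ℂ, (∀ p, ‖X p‖ ≤ M₁ * M₂) →
      ‖∑ p ∈ Eᶜ, ((ν p.1 * ν p.2 : ℝ) : ℂ) * X p‖ ≤ M₁ * M₂ * pairProbNotMem ν E := by
    intro X hX
    calc ‖∑ p ∈ Eᶜ, ((ν p.1 * ν p.2 : ℝ) : ℂ) * X p‖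
        ≤ ∑ p ∈ Eᶜ, ‖((ν p.1 * ν p.2 : ℝ) : ℂ) * X p‖ := norm_sum_le _ _
      _ ≤ ∑ p ∈ Eᶜ, ν p.1 * ν p.2 * (M₁ * M₂) := by
          refine Finset.sum_le_sum fun p _ => ?_
          rw [norm_mul, Complex.norm_real, Real.norm_of_nonneg (mul_nonneg (hν p.1) (hν p.2))]
          exact mul_le_mul_of_nonneg_left (hX p) (mul_nonneg (hν p.1) (hν p.2))
      _ = M₁ * M₂ * pairProbNotMem ν E := by
          rw [pairProbNotMem, ← Finset.sum_mul, mul_comm]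
  have hprod : ∀ a b : Ω, ‖h₁ a * h₂ b‖ ≤ M₁ * M₂ := fun a b => by
    rw [norm_mul]
    exact mul_le_mul (hM₁ a) (hM₂ b) (norm_nonneg _) ((norm_nonneg _).trans (hM₁ a))
  have b₁ := key (fun p => h₁ p.1 * h₂ p.1) fun p => hprod p.1 p.1
  have b₂ := key (fun p => h₁ p.1 * h₂ p.2) fun p => hprod p.1 p.2
  rw [hsplit]
  calc ‖∑ p ∈ Eᶜ, ((ν p.1 * ν p.2 : ℝ) : ℂ) * (h₁ p.1 * h₂ p.1) -
          ∑ p ∈ Eᶜ, ((ν p.1 * ν p.2 : ℝ) : ℂ) * (h₁ p.1 * h₂ p.2)‖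
      ≤ ‖∑ p ∈ Eᶜ, ((ν p.1 * ν p.2 : ℝ) : ℂ) * (h₁ p.1 * h₂ p.1)‖ +
          ‖∑ p ∈ Eᶜ, ((ν p.1 * ν p.2 : ℝ) : ℂ) * (h₁ p.1 * h₂ p.2)‖ := norm_sub_le _ _
    _ ≤ M₁ * M₂ * pairProbNotMem ν E + M₁ * M₂ * pairProbNotMem ν E := add_le_add b₁ b₂
    _ = 2 * M₁ * M₂ * pairProbNotMem ν E := by ring

/-- **Lemma 3.2, as printed.** "Let `E ⊆ Ω²`. Let `h₁, h₂ : Ω → ℂ` be arbitrary functions. Let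
`T : E → E` be a swapping map with respect to `(E, h₁, h₂, ν)`. Let `Ψ₁, Ψ₂` be i.i.d. `∼ ν`. Then
`|Cov(h₁(Ψ₁), h₂(Ψ₁))| ≤ 2 ‖h₁‖_∞ ‖h₂‖_∞ P((Ψ₁, Ψ₂) ∉ E)`." (`Ω` finite, `ν` a probability weight:
in the paper `Ω = Hom(π₁(S₁(Λ),x₀),G)`, `ν = ν_{Λ,β}`; the proof is verbatim the same for any
finite probability space.) [cite: AdhikariCao2025, Lemma 3.2] -/
theorem norm_fcov_le_of_isSwappingMap' [DecidableEq Ω] {ν : Ω → ℝ} (hν : ∀ ω, 0 ≤ ν ω)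
    (hν₁ : ∑ ω, ν ω = 1) {E : Finset (Ω × Ω)} {h₁ h₂ : Ω → ℂ} {T : Ω × Ω → Ω × Ω}
    (hT : IsSwappingMap ν E h₁ h₂ T) :
    ‖fcov ν h₁ h₂‖ ≤ 2 * linftyNorm h₁ * linftyNorm h₂ * pairProbNotMem ν E :=
  norm_fcov_le_of_isSwappingMap hν hν₁ hT (norm_le_linftyNorm h₁) (norm_le_linftyNorm h₂)

/-- The degenerate case `E = Ω²` of Lemma 3.2 (the sketch in §1: a swapping map defined on all of
`Ω²` forces `Cov(h₁(Ψ₁), h₂(Ψ₁)) = 0`). [cite: AdhikariCao2025, §1 (proof sketch after Remark 1.2)] -/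
theorem fcov_eq_zero_of_isSwappingMap_univ [DecidableEq Ω] {ν : Ω → ℝ} (hν : ∀ ω, 0 ≤ ν ω)
    (hν₁ : ∑ ω, ν ω = 1) {h₁ h₂ : Ω → ℂ} {T : Ω × Ω → Ω × Ω}
    (hT : IsSwappingMap ν (Finset.univ : Finset (Ω × Ω)) h₁ h₂ T) : fcov ν h₁ h₂ = 0 := by
  have h := norm_fcov_le_of_isSwappingMap' hν hν₁ hT
  rw [pairProbNotMem, Finset.compl_univ, Finset.sum_empty, mul_zero] at h
  exact norm_le_zero_iff.mp h

end FiniteProbability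

/-! ### The instance `(G^{Λ₁}, μ_{Λ,β})` of `CorrelationDecay.lean` -/

section Gibbs

variable {Λ : Cube} {G : Type*} [Group G] [Fintype G] {d : ℕ}
  (ρ : G →* Matrix (Fin d) (Fin d) ℂ) (β : ℝ)

omit [Fintype G] in
/-- The Boltzmann weight `e^{−βS_Λ(σ)}` is positive. [cite: AdhikariCao2025, §1.2 eq. (1.3)] -/
theorem weight_pos (σ : EdgeConfig Λ G) : 0 < weight ρ β σ := by
  unfold weight
  exact Real.exp_pos _

/-- `Z_{Λ,β} > 0` (a non-empty finite sum of positive weights: the configuration `σ ≡ 1` exists).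
[cite: AdhikariCao2025, §1.2 eq. (1.3)] -/
theorem partitionFn_pos : 0 < partitionFn ρ β Λ := by
  unfold partitionFn
  haveI : Nonempty (EdgeConfig Λ G) := ⟨fun _ => 1⟩
  exact Finset.sum_pos (fun σ _ => weight_pos ρ β σ) Finset.univ_nonempty

/-- `μ_{Λ,β}(σ) > 0`. [cite: AdhikariCao2025, §1.2 eq. (1.3)] -/
theorem gibbsProb_pos (σ : EdgeConfig Λ G) : 0 < gibbsProb ρ β σ :=
  div_pos (weight_pos ρ β σ) (partitionFn_pos ρ β)

/-- `μ_{Λ,β}(σ) ≥ 0`. [cite: AdhikariCao2025, §1.2 eq. (1.3)] -/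
theorem gibbsProb_nonneg (σ : EdgeConfig Λ G) : 0 ≤ gibbsProb ρ β σ :=
  (gibbsProb_pos ρ β σ).le

/-- `μ_{Λ,β}` is a probability: `Σ_σ μ_{Λ,β}(σ) = 1` ("where `Z_{Λ,β}` is the normalizing constant").
[cite: AdhikariCao2025, §1.2 eq. (1.3)] -/
theorem sum_gibbsProb_eq_one : ∑ σ : EdgeConfig Λ G, gibbsProb ρ β σ = 1 := by
  unfold gibbsProb
  rw [← Finset.sum_div, div_eq_one_iff_eq (partitionFn_pos ρ β).ne']
  rfl

/-- The expectation `E[F(Σ)]` of `CorrelationDecay.lean` is `fexpect` for the weight `μ_{Λ,β}`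
(definitionally). [cite: AdhikariCao2025, §1.2] -/
theorem expect_eq_fexpect (F : EdgeConfig Λ G → ℂ) :
    expect ρ β F = fexpect (gibbsProb ρ β) F := rfl

/-- The covariance `Cov(F₁(Σ), F₂(Σ))` of `CorrelationDecay.lean` is `fcov` for the weight `μ_{Λ,β}`
(definitionally). [cite: AdhikariCao2025, Thm. 1.1 and Lemma 3.2] -/
theorem cov_eq_fcov (F₁ F₂ : EdgeConfig Λ G → ℂ) :
    cov ρ β F₁ F₂ = fcov (gibbsProb ρ β) F₁ F₂ := rfl

/-- **Lemma 3.2 on the configuration space `(G^{Λ₁}, μ_{Λ,β})`**: a swapping map `T` on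
`E ⊆ (G^{Λ₁})²` with respect to `(E, F₁, F₂, μ_{Λ,β})` gives
`|Cov(F₁(Σ), F₂(Σ))| ≤ 2 ‖F₁‖_∞ ‖F₂‖_∞ μ_{Λ,β}^{⊗2}(E^c)`. (The paper applies Lemma 3.2 to the
push-forward `ν_{Λ,β}` on based homomorphisms after Lemma 2.12; this is the same abstract lemma
instantiated on the measure (1.3) itself.) [cite: AdhikariCao2025, Lemma 3.2] -/
theorem norm_cov_le_of_isSwappingMap [DecidableEq G]
    {E : Finset (EdgeConfig Λ G × EdgeConfig Λ G)} {F₁ F₂ : EdgeConfig Λ G → ℂ}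
    {T : EdgeConfig Λ G × EdgeConfig Λ G → EdgeConfig Λ G × EdgeConfig Λ G}
    (hT : IsSwappingMap (gibbsProb ρ β) E F₁ F₂ T) :
    ‖cov ρ β F₁ F₂‖ ≤
      2 * linftyNorm F₁ * linftyNorm F₂ * pairProbNotMem (gibbsProb (Λ := Λ) ρ β) E := by
  rw [cov_eq_fcov]
  exact norm_fcov_le_of_isSwappingMap' (gibbsProb_nonneg ρ β) (sum_gibbsProb_eq_one ρ β) hT

end Gibbs

/-! ### §1.2 and Remark 1.2 — Wilson loop observables -/

section WilsonLoops

variable {Λ : Cube} {G : Type*} [Group G]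

/-- The **Wilson loop observable** `W_{γ,χ₀}(σ) := χ₀(σ_γ)`, `σ ∈ G^{Λ₁}`, "associated to `γ, χ₀`"
for a closed loop `γ` and a character `χ₀` of `G` ("there is no relation between `χ₀` and the
character `χ` which appears in the definition (1.2) of `S_Λ`"; typed for any `χ₀ : G → ℂ`), on the
free-boundary cube vocabulary (`EdgeConfig`, `ClosedLoop`, `holonomy`) of `CorrelationDecay.lean`.
The tree's walk-based Wilson loop observables on the infinite lattice `ℤ^d` are
`Literature.MathematicalPhysics.QuantumLattice.wilsonLoopObs` and
`Literature.MathematicalPhysics.QuantumFieldTheory.Cao2020.wilsonLoopVar` (other carriers; not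
restated). [cite: AdhikariCao2025, §1.2] -/
def wilsonLoopObservable (χ₀ : G → ℂ) (γ : ClosedLoop) (σ : EdgeConfig Λ G) : ℂ :=
  χ₀ (holonomy σ γ)

/-- `χ(1) = d` for the character of a `d`-dimensional representation. [cite: AdhikariCao2025, §1.2] -/
theorem character_one {d₀ : ℕ} (ρ₀ : G →* Matrix (Fin d₀) (Fin d₀) ℂ) : character ρ₀ 1 = d₀ := by
  simp [character]

/-- "By the conjugacy invariance of `χ`": the character of a representation is a class function,
`χ(h⁻¹ g h) = χ(g)`. [cite: AdhikariCao2025, §1.2] -/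
theorem character_conj {d₀ : ℕ} (ρ₀ : G →* Matrix (Fin d₀) (Fin d₀) ℂ) (g h : G) :
    character ρ₀ (h⁻¹ * g * h) = character ρ₀ g := by
  unfold character
  rw [map_mul, map_mul, Matrix.trace_mul_cycle, ← map_mul, mul_inv_cancel, map_one, one_mul]

/-- `|χ(g)| ≤ d` for the character of a UNITARY representation of dimension `d` (every entry of a
unitary matrix has modulus `≤ 1`). [cite: AdhikariCao2025, §1.2] -/
theorem norm_character_le {d₀ : ℕ} {ρ₀ : G →* Matrix (Fin d₀) (Fin d₀) ℂ} (hρ₀ : IsUnitaryRep ρ₀)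
    (g : G) : ‖character ρ₀ g‖ ≤ d₀ := by
  unfold character Matrix.trace
  calc ‖∑ i, Matrix.diag (ρ₀ g) i‖ ≤ ∑ i, ‖Matrix.diag (ρ₀ g) i‖ := norm_sum_le _ _
    _ ≤ ∑ _i : Fin d₀, (1 : ℝ) :=
        Finset.sum_le_sum fun i _ => entry_norm_bound_of_unitary (hρ₀ g) i i
    _ = d₀ := by simp

/-- `‖χ‖_∞ ≤ d` for the character of a unitary representation of dimension `d`.
[cite: AdhikariCao2025, §1.2] -/
theorem linftyNorm_character_le {d₀ : ℕ} {ρ₀ : G →* Matrix (Fin d₀) (Fin d₀) ℂ}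
    (hρ₀ : IsUnitaryRep ρ₀) : linftyNorm (character ρ₀) ≤ d₀ :=
  linftyNorm_le (Nat.cast_nonneg d₀) (norm_character_le hρ₀)

/-- Remark 1.2, the mechanism: "arbitrary functions of arbitrary numbers of Wilson loop observables"
are conjugacy invariant in the sense of Theorem 1.1 — if each `φ_j : G → ℂ` is a class function
then `(g₁,…,g_k) ↦ F(φ₁(g₁),…,φ_k(g_k))` is invariant under independent conjugations of the slots.
[cite: AdhikariCao2025, Remark 1.2] -/
theorem isConjInvariant_of_classFunctions {k : ℕ} (φ : Fin k → G → ℂ)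
    (hφ : ∀ j (g h : G), φ j (h⁻¹ * g * h) = φ j g) (F : (Fin k → ℂ) → ℂ) :
    IsConjInvariant (fun g : Fin k → G => F fun j => φ j (g j)) := by
  intro g h
  show F (fun j => φ j ((h j)⁻¹ * g j * h j)) = F fun j => φ j (g j)
  simp only [hφ]

/-- A single Wilson loop observable `W_{γ,χ₀}`, `χ₀ = Tr ρ₀`, is of the form of Theorem 1.1 with
`k = 1`, `f = χ₀`. [cite: AdhikariCao2025, Remark 1.2] -/
theorem isConjInvariant_character_comp {d₀ : ℕ} (ρ₀ : G →* Matrix (Fin d₀) (Fin d₀) ℂ) :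
    IsConjInvariant (fun g : Fin 1 → G => character ρ₀ (g 0)) :=
  isConjInvariant_of_classFunctions (fun _ => character ρ₀) (fun _ g h => character_conj ρ₀ g h)
    fun z => z 0

omit [Group G] in
/-- For `k = 1` the sup norm over `G^1` of `g ↦ χ₀(g₁)` is `‖χ₀‖_∞`.
[cite: AdhikariCao2025, Thm. 1.1] -/
theorem supNorm_comp_eval_zero [Nonempty G] (χ₀ : G → ℂ) :
    supNorm (fun g : Fin 1 → G => χ₀ (g 0)) = linftyNorm χ₀ := by
  show (⨆ g : Fin 1 → G, ‖χ₀ (g 0)‖) = ⨆ x : G, ‖χ₀ x‖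
  exact (Function.surjective_eval (β := fun _ : Fin 1 => G) (0 : Fin 1)).iSup_comp
    (fun x : G => ‖χ₀ x‖)

end WilsonLoops

/-! ### Remark 1.2 — the corollaries of Theorem 1.1, derived from the named fact `correlationDecay` -/

section Corollaries

/-- **Remark 1.2, general form (derived from `correlationDecay`).** Under the hypotheses of
Theorem 1.1, for class functions `φ^{(i)}_j : G → ℂ`, arbitrary `F_i : ℂ^{k_i} → ℂ` and closed loops
`γ^{(i)}_j ⊆ B_i`, the observables `F_i(W_{γ^{(i)}_1,φ^{(i)}_1}, …, W_{γ^{(i)}_{k_i},φ^{(i)}_{k_i}})`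
("arbitrary functions of arbitrary numbers of Wilson loop observables") satisfy the bound of
Theorem 1.1. [cite: AdhikariCao2025, Thm. 1.1 and Remark 1.2] -/
theorem correlationDecay.classFunctions (hcd : correlationDecay)
    (G : Type) [Group G] [Fintype G] (d : ℕ) (ρ : G →* Matrix (Fin d) (Fin d) ℂ)
    (hρ : IsUnitaryRep ρ) (Λ : Cube) (β : ℝ)
    (hβ : 114 + 4 * Real.log (Fintype.card G) ≤ deltaG ρ * β) (L : ℝ) (hL : 0 ≤ L)
    (B₁ B₂ : Rectangle) (hB₁ : B₁.lo ≤ B₁.hi) (hB₂ : B₂.lo ≤ B₂.hi)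
    (hB₁Λ : B₁.vertices ⊆ Λ.vertices) (hB₂Λ : B₂.vertices ⊆ Λ.vertices)
    (hdist : ∀ x ∈ B₁.vertices, ∀ y ∈ B₂.vertices, L ≤ linfDist x y)
    (k₁ k₂ : ℕ) (hk₁ : 1 ≤ k₁) (hk₂ : 1 ≤ k₂) (φ₁ : Fin k₁ → G → ℂ) (φ₂ : Fin k₂ → G → ℂ)
    (hφ₁ : ∀ j (g h : G), φ₁ j (h⁻¹ * g * h) = φ₁ j g)
    (hφ₂ : ∀ j (g h : G), φ₂ j (h⁻¹ * g * h) = φ₂ j g)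
    (F₁ : (Fin k₁ → ℂ) → ℂ) (F₂ : (Fin k₂ → ℂ) → ℂ)
    (γ₁ : Fin k₁ → ClosedLoop) (γ₂ : Fin k₂ → ClosedLoop)
    (hγ₁ : ∀ j, (γ₁ j).ContainedIn B₁.vertices) (hγ₂ : ∀ j, (γ₂ j).ContainedIn B₂.vertices) :
    ‖cov (Λ := Λ) ρ β (fun σ => F₁ fun j => wilsonLoopObservable (φ₁ j) (γ₁ j) σ)
        (fun σ => F₂ fun j => wilsonLoopObservable (φ₂ j) (γ₂ j) σ)‖ ≤
      4 * (4 * 10 ^ 24 * (Fintype.card G : ℝ) ^ 2) ^ (B₁.plaqCount + B₂.plaqCount) *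
        supNorm (fun g : Fin k₁ → G => F₁ fun j => φ₁ j (g j)) *
        supNorm (fun g : Fin k₂ → G => F₂ fun j => φ₂ j (g j)) *
        Real.exp (-(β / 2) * deltaG ρ * (L - 1)) :=
  hcd G d ρ hρ Λ β hβ L hL B₁ B₂ hB₁ hB₂ hB₁Λ hB₂Λ hdist k₁ k₂ hk₁ hk₂
    (fun g : Fin k₁ → G => F₁ fun j => φ₁ j (g j)) (fun g : Fin k₂ → G => F₂ fun j => φ₂ j (g j))
    (isConjInvariant_of_classFunctions φ₁ hφ₁ F₁) (isConjInvariant_of_classFunctions φ₂ hφ₂ F₂)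
    γ₁ γ₂ hγ₁ hγ₂

/-- **Remark 1.2, Wilson loops (derived from `correlationDecay`).** Under the hypotheses of
Theorem 1.1 (finite `G`, unitary `ρ` of dimension `d`, cube `Λ`, `β ≥ (1/Δ_G)(114 + 4 log|G|)`,
rectangles `B₁, B₂ ⊆ Λ` at `ℓ^∞` distance `≥ L ≥ 0`), for characters `χ_i = Tr ρ_i` of
representations `ρ_i` of `G` and closed loops `γ_i` contained in `B_i` (`i = 1, 2`):
`|Cov(W_{γ₁,χ₁}(Σ), W_{γ₂,χ₂}(Σ))| ≤ 4 (4·10²⁴|G|²)^{|B₁|+|B₂|} ‖χ₁‖_∞ ‖χ₂‖_∞ e^{−(β/2)Δ_G(L−1)}`,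
`Σ ∼ μ_{Λ,β}`. [cite: AdhikariCao2025, Thm. 1.1 and Remark 1.2] -/
theorem correlationDecay.wilsonLoops (hcd : correlationDecay)
    (G : Type) [Group G] [Fintype G] (d : ℕ) (ρ : G →* Matrix (Fin d) (Fin d) ℂ)
    (hρ : IsUnitaryRep ρ) (Λ : Cube) (β : ℝ)
    (hβ : 114 + 4 * Real.log (Fintype.card G) ≤ deltaG ρ * β) (L : ℝ) (hL : 0 ≤ L)
    (B₁ B₂ : Rectangle) (hB₁ : B₁.lo ≤ B₁.hi) (hB₂ : B₂.lo ≤ B₂.hi)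
    (hB₁Λ : B₁.vertices ⊆ Λ.vertices) (hB₂Λ : B₂.vertices ⊆ Λ.vertices)
    (hdist : ∀ x ∈ B₁.vertices, ∀ y ∈ B₂.vertices, L ≤ linfDist x y)
    {d₁ d₂ : ℕ} (ρ₁ : G →* Matrix (Fin d₁) (Fin d₁) ℂ) (ρ₂ : G →* Matrix (Fin d₂) (Fin d₂) ℂ)
    (γ₁ γ₂ : ClosedLoop) (hγ₁ : γ₁.ContainedIn B₁.vertices) (hγ₂ : γ₂.ContainedIn B₂.vertices) :
    ‖cov (Λ := Λ) ρ β (wilsonLoopObservable (character ρ₁) γ₁)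
        (wilsonLoopObservable (character ρ₂) γ₂)‖ ≤
      4 * (4 * 10 ^ 24 * (Fintype.card G : ℝ) ^ 2) ^ (B₁.plaqCount + B₂.plaqCount) *
        linftyNorm (character ρ₁) * linftyNorm (character ρ₂) *
        Real.exp (-(β / 2) * deltaG ρ * (L - 1)) := by
  have h := hcd G d ρ hρ Λ β hβ L hL B₁ B₂ hB₁ hB₂ hB₁Λ hB₂Λ hdist 1 1 le_rfl le_rfl
    (fun g : Fin 1 → G => character ρ₁ (g 0)) (fun g : Fin 1 → G => character ρ₂ (g 0))
    (isConjInvariant_character_comp ρ₁) (isConjInvariant_character_comp ρ₂)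
    (fun _ => γ₁) (fun _ => γ₂) (fun _ => hγ₁) (fun _ => hγ₂)
  rw [supNorm_comp_eval_zero, supNorm_comp_eval_zero] at h
  exact h

/-- **Remark 1.2, Wilson loops of UNITARY representations, explicit constant** (derived from
`correlationDecay` and `‖Tr ρ_i‖_∞ ≤ d_i`):
`|Cov(W_{γ₁,χ₁}, W_{γ₂,χ₂})| ≤ 4 (4·10²⁴|G|²)^{|B₁|+|B₂|} d₁ d₂ e^{−(β/2)Δ_G(L−1)}`.
[cite: AdhikariCao2025, Thm. 1.1 and Remark 1.2] -/
theorem correlationDecay.wilsonLoops_unitary (hcd : correlationDecay)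
    (G : Type) [Group G] [Fintype G] (d : ℕ) (ρ : G →* Matrix (Fin d) (Fin d) ℂ)
    (hρ : IsUnitaryRep ρ) (Λ : Cube) (β : ℝ)
    (hβ : 114 + 4 * Real.log (Fintype.card G) ≤ deltaG ρ * β) (L : ℝ) (hL : 0 ≤ L)
    (B₁ B₂ : Rectangle) (hB₁ : B₁.lo ≤ B₁.hi) (hB₂ : B₂.lo ≤ B₂.hi)
    (hB₁Λ : B₁.vertices ⊆ Λ.vertices) (hB₂Λ : B₂.vertices ⊆ Λ.vertices)
    (hdist : ∀ x ∈ B₁.vertices, ∀ y ∈ B₂.vertices, L ≤ linfDist x y)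
    {d₁ d₂ : ℕ} {ρ₁ : G →* Matrix (Fin d₁) (Fin d₁) ℂ} {ρ₂ : G →* Matrix (Fin d₂) (Fin d₂) ℂ}
    (hρ₁ : IsUnitaryRep ρ₁) (hρ₂ : IsUnitaryRep ρ₂)
    (γ₁ γ₂ : ClosedLoop) (hγ₁ : γ₁.ContainedIn B₁.vertices) (hγ₂ : γ₂.ContainedIn B₂.vertices) :
    ‖cov (Λ := Λ) ρ β (wilsonLoopObservable (character ρ₁) γ₁)
        (wilsonLoopObservable (character ρ₂) γ₂)‖ ≤
      4 * (4 * 10 ^ 24 * (Fintype.card G : ℝ) ^ 2) ^ (B₁.plaqCount + B₂.plaqCount) *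
        (d₁ * d₂) * Real.exp (-(β / 2) * deltaG ρ * (L - 1)) := by
  refine (correlationDecay.wilsonLoops hcd G d ρ hρ Λ β hβ L hL B₁ B₂ hB₁ hB₂ hB₁Λ hB₂Λ hdist
    ρ₁ ρ₂ γ₁ γ₂ hγ₁ hγ₂).trans ?_
  have hC : 0 ≤ 4 * (4 * 10 ^ 24 * (Fintype.card G : ℝ) ^ 2) ^ (B₁.plaqCount + B₂.plaqCount) :=
    by positivity
  have h₁ := linftyNorm_character_le hρ₁
  have h₂ := linftyNorm_character_le hρ₂
  have h₁' := linftyNorm_nonneg (character ρ₁)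
  have h₂' := linftyNorm_nonneg (character ρ₂)
  have hexp := (Real.exp_pos (-(β / 2) * deltaG ρ * (L - 1))).le
  have hmul : linftyNorm (character ρ₁) * linftyNorm (character ρ₂) ≤ d₁ * d₂ :=
    mul_le_mul h₁ h₂ h₂' (Nat.cast_nonneg d₁)
  calc 4 * (4 * 10 ^ 24 * (Fintype.card G : ℝ) ^ 2) ^ (B₁.plaqCount + B₂.plaqCount) *
          linftyNorm (character ρ₁) * linftyNorm (character ρ₂) *
          Real.exp (-(β / 2) * deltaG ρ * (L - 1))
      = 4 * (4 * 10 ^ 24 * (Fintype.card G : ℝ) ^ 2) ^ (B₁.plaqCount + B₂.plaqCount) *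
          (linftyNorm (character ρ₁) * linftyNorm (character ρ₂)) *
          Real.exp (-(β / 2) * deltaG ρ * (L - 1)) := by ring
    _ ≤ 4 * (4 * 10 ^ 24 * (Fintype.card G : ℝ) ^ 2) ^ (B₁.plaqCount + B₂.plaqCount) *
          (d₁ * d₂) * Real.exp (-(β / 2) * deltaG ρ * (L - 1)) :=
        mul_le_mul_of_nonneg_right (mul_le_mul_of_nonneg_left hmul hC) hexp

end Corollaries

end Literature.MathematicalPhysics.QuantumFieldTheory.AdhikariCao2022

end
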